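import Summits.NavierStokesRegularity.NavierStokesRegularity.Theorems.ScenarioCensusRowA8HonestBoost

/-!
# Screw Oseen gauge — part 3/4: the seam (axis dichotomy), F, kernel glue, and row A8 ≡ cell A8gen

`row_A8_iff_row_A8gen : ScenarioCensus.Row_A8 ↔ Row_A8gen` (in kernel: the census row A8 IS its honest cell),
with the census alias `ScenarioCensus.row_A8_iff_row_A8gen`.

Part 3 of the four-file re-homing of ns-idea-3's `ScenarioCensusScrewGauge.lean` (sha16 27b7018076f2c110; LINE 5
«honest-gauge» rev 4); overview and provenance in part 1 (`ScenarioCensusRowA8HonestGauge.lean`), boosts / O3b′ /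
period algebra in part 2 (`ScenarioCensusRowA8HonestBoost.lean`), the A5 cell in part 4
(`ScenarioCensusRowA5HonestCell.lean`).  Contents (verbatim, duplicate rotation helpers `private`): §2 rotation
algebra; seam `axisDichotomy_of_period` / `axisDichotomy_holds` (O3 from O3a + O3b′: chords of the period circle
span the horizontal plane); §4 F `forwardRigidity_holds`; `hor_eq_of_twist`; §6 kernel glue `row_A8_of_honest`,
`row_A8_of_row_A8gen`, converse `row_A8gen_of_row_A8`, headline.
No census value changes: `Row_A8` and `Row_A8gen` remain OPEN (they are now one statement).
NS regularity is NOT proved; no summit statement is proved by this file.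
-/

noncomputable section

open MeasureTheory Set Filter Topology Function Metric
open scoped ENNReal NNReal

set_option linter.dupNamespace false

namespace Summit.NavierStokesRegularity.NavierStokesRegularity.Theorems.ScenarioCensus.RowA8HonestCell

open Literature.Analysis Literature.Analysis.FluidPDE Literature.Analysis.UnboundedOperators
open Summit.NavierStokesRegularity.NavierStokesRegularity.Theorems.ScenarioCensus (Row_A8)
open Summit.NavierStokesRegularity.NavierStokesRegularity.Theorems.ScenarioCensus.PitchDefect
  (helical_transfer twist_eq_twist_of_tendsto tendsto_setAverage_sub_of_oseenMild)

/-! ## §2  Rotation algebra -/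

/-- `R_θ` is additive. -/
private theorem rotZ_add_vec (θ : ℝ) (x y : E3) : rotZ θ (x + y) = rotZ θ x + rotZ θ y := by
  ext i; fin_cases i <;> simp [rotZ] <;> ring

/-- `R_θ` commutes with subtraction. -/
private theorem rotZ_sub_vec (θ : ℝ) (x y : E3) : rotZ θ (x - y) = rotZ θ x - rotZ θ y := by
  ext i; fin_cases i <;> simp [rotZ] <;> ring

/-- `R_θ` fixes the axis: `R_θ (L e₃) = L e₃`. -/
theorem rotZ_smul_e3 (θ L : ℝ) : rotZ θ (L • e3) = L • e3 := by
  ext i; fin_cases i <;> simp [rotZ, e3]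

/-- `R_{2π}` is the identity. -/
private theorem rotZ_two_pi (x : E3) : rotZ (2 * Real.pi) x = x := by
  ext i; fin_cases i <;> simp [rotZ]

/-- `R_{−θ} (R_θ x) = x`. -/
private theorem rotZ_neg_rotZ' (θ : ℝ) (x : E3) : rotZ (-θ) (rotZ θ x) = x := by
  have hsc := Real.sin_sq_add_cos_sq θ
  ext i; fin_cases i <;> simp [rotZ, Real.cos_neg, Real.sin_neg]
  · linear_combination (x 0) * hsc
  · linear_combination (x 1) * hsc

/-- `R_θ (R_{−θ} x) = x`. -/
private theorem rotZ_rotZ_neg' (θ : ℝ) (x : E3) : rotZ θ (rotZ (-θ) x) = x := by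
  have h := rotZ_neg_rotZ' (-θ) x
  rwa [neg_neg] at h

/-- `R_θ 0 = 0`. -/
private theorem rotZ_zero_vec' (θ : ℝ) : rotZ θ (0 : E3) = 0 := by
  ext i; fin_cases i <;> simp [rotZ]

/-- a vector fixed by the quarter turn is axial. -/
theorem eq_axial_of_rotZ_half_pi {d : E3} (hd : rotZ (Real.pi / 2) d = d) : d = (d 2) • e3 := by
  have h0 := congrFun (congrArg (fun z : E3 => (z : Fin 3 → ℝ)) hd) 0
  have h1 := congrFun (congrArg (fun z : E3 => (z : Fin 3 → ℝ)) hd) 1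
  simp [rotZ] at h0 h1
  ext i; fin_cases i <;> simp [e3] <;> linarith

/-- `d = hor d + d₃ e₃`. -/
theorem self_eq_hor_add (d : E3) : d = hor d + (d 2) • e3 := by
  simp [hor]

/-- The horizontal part has vanishing third component. -/
theorem hor_apply_two (d : E3) : hor d 2 = 0 := by
  simp [hor, e3]

/-- **The seam, rev 4**: O3 from O3a and the PERIOD lemma O3b′ alone (no line upgrade, no continuity of the
frame used): for a non-shear time `τ₂` and `τ₁ < τ₂`, the twisted screw isometries `θ ∈ ℝ` give the periods
`Δ − R_{−θ}Δ` of `v τ₂` (`Δ` = the horizontal Galilean defect); sums and differences of opposite chords are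
`(2 − 2cos θ)Δ_h` and `(2 sin θ)R_{π/2}Δ_h`, which with integer multiples exhaust the lines `ℝΔ_h`, `ℝR_{π/2}Δ_h`,
hence the horizontal plane if `Δ_h ≠ 0` — contradiction; so `Δ_h = 0`, i.e. the axis moves uniformly. -/
theorem axisDichotomy_of_period (hI : IsometryCovariance) (hG : GalileanDefectPeriod) : AxisDichotomy := by
  intro h v A cbar hgen _hA hsym
  rw [or_iff_not_imp_left]
  intro hns
  push Not at hns
  obtain ⟨τ₂, hτ₂, d₀, hd₀, y₀, hy₀⟩ := hns
  refine ⟨τ₂, hτ₂, ?_⟩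
  intro τ₁ hτ₁
  rcases hτ₁.lt_or_eq with hlt | rfl
  swap
  · simp
  -- the Galilean defect of the pair (τ₁, τ₂)
  set Δ : E3 := A τ₁ - A τ₂ + (τ₂ - τ₁) • cbar with hΔ
  -- every chord `Δ − R_{−θ} Δ` is a period of `v τ₂`
  have hP : ∀ (θ : ℝ) (y : E3), v τ₂ (y + (Δ - rotZ (-θ) Δ)) = v τ₂ y := by
    intro θ
    set D : E3 := rotZ θ (A τ₂) - A τ₂ + (h * θ) • e3 with hD
    set ε : ℝ → E3 := fun τ => (A τ₂ - A τ) - rotZ (-θ) (A τ₂ - A τ) with hε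
    set k : E3 := cbar - rotZ (-θ) cbar with hk
    have hW : ∃ W : ℝ → E3 → E3, IsGenuine 0 W ∧ ∀ τ < 0, ∀ y, W τ y = v τ (y + ε τ) + k := by
      refine ⟨fun τ y => rotZ (-θ) (v τ (rotZ θ y + D)), hI 0 v θ D hgen, ?_⟩
      intro τ hτ y
      have hpt : rotZ θ y + D = rotZ θ (y + ε τ) + (rotZ θ (A τ) - A τ + (h * θ) • e3) := by
        rw [hD, hε]
        simp only [rotZ_add_vec, rotZ_sub_vec, rotZ_rotZ_neg']
        abel
      show rotZ (-θ) (v τ (rotZ θ y + D)) = v τ (y + ε τ) + k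
      rw [hpt, hsym τ hτ θ (y + ε τ), rotZ_add_vec, rotZ_neg_rotZ', rotZ_sub_vec, rotZ_neg_rotZ', hk]
    intro y
    have key := hG 0 v ε k hgen hW τ₁ τ₂ hlt hτ₂ y
    have hε₂ : ε τ₂ = 0 := by rw [hε]; simp [rotZ_zero_vec']
    have hdef : ε τ₂ - ε τ₁ + (τ₂ - τ₁) • k = Δ - rotZ (-θ) Δ := by
      rw [hε₂, hε, hk, hΔ]
      simp only [rotZ_add_vec, rotZ_sub_vec, smul_sub, zero_sub]
      have hs : rotZ (-θ) ((τ₂ - τ₁) • cbar) = (τ₂ - τ₁) • rotZ (-θ) cbar := by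
        ext i; fin_cases i <;> simp [rotZ] <;> ring
      rw [hs]
      abel
    rw [hdef] at key
    exact key
  -- chords: the lines `ℝ Δ_h` and `ℝ R_{π/2} Δ_h` consist of periods
  have hcos : ∀ (φ : ℝ) (y : E3), v τ₂ (y + (2 - 2 * Real.cos φ) • hor Δ) = v τ₂ y := by
    intro φ y
    rw [← chord_add]
    have h2 := hP (-φ)
    rw [neg_neg] at h2
    exact period_add (hP φ) h2 y
  have hsin : ∀ (φ : ℝ) (y : E3), v τ₂ (y + (2 * Real.sin φ) • rotZ (Real.pi / 2) (hor Δ)) = v τ₂ y := by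
    intro φ y
    rw [← chord_sub, sub_eq_add_neg]
    have h2 := hP (-φ)
    rw [neg_neg] at h2
    exact period_add (hP φ) (period_neg h2) y
  have hl₁ : ∀ (r : ℝ) (y : E3), v τ₂ (y + r • hor Δ) = v τ₂ y := by
    intro r
    obtain ⟨m, φ, hr⟩ := exists_int_cos r
    have h4 : ∀ y, v τ₂ (y + (4 : ℝ) • hor Δ) = v τ₂ y := by
      have h := hcos Real.pi
      rw [Real.cos_pi] at h
      norm_num at h
      exact h
    intro y
    rw [hr, add_smul, show (4 * (m : ℝ)) • hor Δ = (m : ℝ) • ((4 : ℝ) • hor Δ) by rw [mul_comm, mul_smul]]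
    exact period_add (period_intMul h4 m) (hcos φ) y
  have hl₂ : ∀ (r : ℝ) (y : E3), v τ₂ (y + r • rotZ (Real.pi / 2) (hor Δ)) = v τ₂ y := by
    intro r
    obtain ⟨m, φ, hr⟩ := exists_int_sin r
    have h2 : ∀ y, v τ₂ (y + (2 : ℝ) • rotZ (Real.pi / 2) (hor Δ)) = v τ₂ y := by
      have h := hsin (Real.pi / 2)
      rw [Real.sin_pi_div_two, mul_one] at h
      exact h
    intro y
    rw [hr, add_smul, show (2 * (m : ℝ)) • rotZ (Real.pi / 2) (hor Δ) =
      (m : ℝ) • ((2 : ℝ) • rotZ (Real.pi / 2) (hor Δ)) by rw [mul_comm, mul_smul]]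
    exact period_add (period_intMul h2 m) (hsin φ) y
  -- if `Δ_h ≠ 0` the two lines span the horizontal plane: shear at τ₂, contradiction
  by_contra hne
  have hΔh : hor Δ ≠ 0 := by
    intro h0
    apply hne
    have h1 : hor Δ = hor (A τ₁) - hor (A τ₂) + (τ₂ - τ₁) • hor cbar := by
      rw [hΔ]
      simp only [hor, PiLp.add_apply, PiLp.sub_apply, PiLp.smul_apply, smul_eq_mul, add_smul,
        sub_smul, mul_smul]
      simp only [smul_sub]
      abel
    rw [h1] at h0
    have : hor (A τ₁) = hor (A τ₂) - (τ₂ - τ₁) • hor cbar := by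
      rw [← sub_eq_zero]; rw [← h0]; abel
    rw [this, show τ₁ - τ₂ = -(τ₂ - τ₁) by ring, neg_smul]
    abel
  apply hy₀
  obtain ⟨a, b, hab⟩ := exists_combo_hor hΔh hd₀
  rw [hab]
  exact period_add (hl₁ a) (hl₂ b) y₀

/-- O3 is a theorem. -/
theorem axisDichotomy_holds : AxisDichotomy :=
  axisDichotomy_of_period isometryCovariance_holds galileanDefectPeriod_holds

/-! ## §4  F is a theorem (Oseen gauge + forward uniqueness from constant data) -/

/-- **F is a theorem**: forward rigidity from constant data (tree Oseen gauge + forward uniqueness of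
bounded Oseen-mild fields against constant data). -/
theorem forwardRigidity_holds : ForwardRigidity := by
  intro u hu hmeas t₀ ht₀ hpast t ht
  obtain ⟨v, A, c, hvm, hvc, ⟨K, hK⟩, -, hvmild, -, hrep⟩ :=
    Summit.NavierStokesRegularity.NavierStokesRegularity.Theorems.oseen_gauge_of_aestronglyMeasurable
      u hu hmeas
  have hvslice : ∀ τ < 0, Continuous (v τ) := fun τ hτ =>
    hvc.comp_continuous (Continuous.prodMk_right τ) fun y => ⟨hτ, mem_univ y⟩
  -- Step 1: before `t₀` every slice of the genuine representative `v` is constant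
  have hconst : ∀ s : ℝ, s < t₀ → v s = fun _ => v s 0 := by
    intro s hs
    have hs0 : s < 0 := hs.trans ht₀
    obtain ⟨b, hb⟩ := hpast s hs
    have h1 : (fun x => v s (x - A s)) =ᵐ[volume] fun _ => b - c s := by
      filter_upwards [hb, hrep s hs0] with x hx hx'
      have : v s (x - A s) + c s = b := by rw [← hx']; exact hx
      exact eq_sub_of_add_eq this
    have hcont : Continuous fun x => v s (x - A s) := (hvslice s hs0).comp (continuous_sub_right _)
    have h2 : (fun x => v s (x - A s)) = fun _ => b - c s :=
      (Continuous.ae_eq_iff_eq volume hcont continuous_const).1 h1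
    funext y
    have hy := congrFun h2 (y + A s)
    have h0 := congrFun h2 (0 + A s)
    simp only [add_sub_cancel_right] at hy h0
    rw [hy, h0]
  -- Step 2: forward uniqueness against the constant solution on `(t₀ - 1, 0)`
  set s : ℝ := t₀ - 1 with hs_def
  have hst₀ : s < t₀ := by rw [hs_def]; linarith
  have hs0 : s < 0 := hst₀.trans ht₀
  set k : E3 := v s 0 with hk_def
  have hvs : v s = fun _ => k := hconst s hst₀
  set M : ℝ := max K ‖k‖ with hM_def
  have hM0 : 0 ≤ M := le_max_of_le_right (norm_nonneg _)
  have hum : AEStronglyMeasurable (uncurry v)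
      ((volume : Measure (ℝ × E3)).restrict (Ioo s 0 ×ˢ univ)) :=
    hvm.aestronglyMeasurable
  have hwm : AEStronglyMeasurable (uncurry fun (_ : ℝ) (_ : E3) => k)
      ((volume : Measure (ℝ × E3)).restrict (Ioo s 0 ×ˢ univ)) :=
    aestronglyMeasurable_const
  have hvM : ∀ τ ∈ Ioo s 0, ∀ y, ‖v τ y‖ ≤ M := fun τ hτ y => (hK τ hτ.2 y).trans (le_max_left _ _)
  have hwM : ∀ τ ∈ Ioo s 0, ∀ y : E3, ‖(fun (_ : ℝ) (_ : E3) => k) τ y‖ ≤ M :=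
    fun τ hτ y => le_max_right _ _
  have hv_eq : ∀ t' ∈ Ioo s 0,
      v t' =ᵐ[volume] fun x => heatExtension (v s) (t' - s) x - oseenDuhamel 1 s v v t' x :=
    fun t' ht' => ae_of_all _ fun x => hvmild s t' ht'.1 ht'.2 x
  have hw_eq : ∀ t' ∈ Ioo s 0,
      (fun (_ : ℝ) (_ : E3) => k) t' =ᵐ[volume] fun x =>
        heatExtension (v s) (t' - s) x -
          oseenDuhamel 1 s (fun (_ : ℝ) (_ : E3) => k) (fun (_ : ℝ) (_ : E3) => k) t' x := by
    intro t' ht'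
    refine ae_of_all _ fun x => ?_
    have h1 : heatExtension (v s) (t' - s) x = k := by
      rw [hvs]; exact heatExtension_const k (sub_pos.2 ht'.1) x
    have h2 : oseenDuhamel 1 s (fun (_ : ℝ) (_ : E3) => k) (fun (_ : ℝ) (_ : E3) => k) t' x = 0 :=
      oseenDuhamel_eq_zero_of_const (b := fun _ => k) (c := fun _ => k)
        (fun _ _ _ => rfl) (fun _ _ _ => rfl) x
    simp [h1, h2]
  have huniq := oseenMild_bounded_unique (u := v) (v := fun (_ : ℝ) (_ : E3) => k)
    (U := fun t' x => heatExtension (v s) (t' - s) x) one_pos hM0 hum hwm hvM hwM hv_eq hw_eq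
  -- Step 3: conclude at the given time `t`
  rcases lt_or_ge t t₀ with h | h
  · exact hpast t h
  · have htI : t ∈ Ioo s 0 := ⟨by linarith, ht⟩
    have hvt : v t =ᵐ[volume] fun _ => k := huniq t htI
    have hvt' : v t = fun _ => k :=
      (Continuous.ae_eq_iff_eq volume (hvslice t ht) continuous_const).1 hvt
    refine ⟨k + c t, ?_⟩
    filter_upwards [hrep t ht] with x hx
    rw [hx, hvt']

/-- twist equality for all angles makes the gauge difference axial. -/
theorem hor_eq_of_twist {c d : E3} (h : ∀ θ : ℝ, rotZ θ c - c = rotZ θ d - d) : hor c = hor d := by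
  have h1 : rotZ (Real.pi / 2) (c - d) = c - d := by
    rw [rotZ_sub_vec]
    have h' := h (Real.pi / 2)
    calc rotZ (Real.pi / 2) c - rotZ (Real.pi / 2) d
        = (rotZ (Real.pi / 2) c - c) - (rotZ (Real.pi / 2) d - d) + (c - d) := by abel
      _ = c - d := by rw [h']; abel
  have hax := eq_axial_of_rotZ_half_pi h1
  have hl : hor (c - d) = hor c - hor d := by
    simp only [hor, PiLp.sub_apply, sub_smul]
    abel
  have h0 : hor (c - d) = 0 := by
    rw [hor]
    nth_rewrite 1 [hax]
    simp
  rw [hl] at h0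
  exact sub_eq_zero.1 h0

/-- **The honest reduction of census row A8** (kernel-checked): from O1/O2 (pitch `h`), the axis dichotomy O3,
Galilean boosts O5, forward rigidity F, the one-direction Liouville (shear branch) and the cell A8gen. -/
theorem row_A8_of_honest (hO1 : HelicalOseenGauge) (hO2 : TwistRigidity) (hO3 : AxisDichotomy)
    (hO5 : GalileanBoost) (hH : Row_A8gen) : Row_A8 := by
  intro h hh u hu hmeas hsym
  obtain ⟨v, A, c, hgen, hA, hrep, hsymv⟩ := hO1 h u hu hmeas hsym
  -- O2: the twist is constant; fix the reference gauge vector `cbar = c(−1)`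
  set cbar : E3 := c (-1) with hcbar
  have htw : ∀ t < 0, ∀ θ : ℝ, rotZ θ (c t) - c t = rotZ θ cbar - cbar :=
    fun t ht θ => hO2 h v A c hgen hsymv (-1) (by norm_num) t ht θ
  have hhor : ∀ t < 0, hor (c t) = hor cbar := fun t ht => hor_eq_of_twist (htw t ht)
  have hsymv' : ∀ t < 0, ∀ (θ : ℝ) (y : E3),
      v t (rotZ θ y + (rotZ θ (A t) - A t + (h * θ) • e3)) = rotZ θ (v t y) + (rotZ θ cbar - cbar) := by
    intro t ht θ y; rw [hsymv t ht θ y, htw t ht θ]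
  rcases hO3 h v A cbar hgen hA hsymv' with hshear | ⟨τ₂, hτ₂, haff⟩
  · -- Case II: every slice is a horizontal shear; ONE direction of invariance already forces constancy
    have he : (EuclideanSpace.single 0 (1 : ℝ) : E3) ≠ 0 := by
      intro h0
      have := congr_arg (fun w : E3 => w 0) h0
      simp at this
    have hconst : ∀ τ < 0, ∀ y, v τ y = v τ 0 :=
      hgen.eq_of_invariant_along he fun t ht x δ =>
        hshear t ht (δ • EuclideanSpace.single 0 (1 : ℝ)) (by simp) x
    intro t ht
    refine ⟨v t 0 + c t, ?_⟩
    filter_upwards [hrep t ht] with x hx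
    rw [hx, hconst t ht]
  · -- Case I: on the backward end `τ ≤ τ₂` the axis moves uniformly with velocity `hor cbar`;
    -- boost honestly by that velocity: the boosted genuine field is EXACTLY helical.
    set k : E3 := hor cbar with hk
    set α : E3 := hor (A τ₂) - τ₂ • k with hα
    set Z : ℝ → E3 → E3 := fun τ y => v τ (y - α - τ • k) + k with hZ
    have hZgen : IsGenuine τ₂ Z := (hO5 v α k hgen).mono hτ₂.le
    -- the representation of `u` through `Z` has AXIAL frame and gauge on `τ ≤ τ₂`
    have hrepZ : ∀ τ < τ₂, u τ =ᵐ[volume] fun x => Z τ (x - (A τ 2) • e3) + (c τ 2) • e3 := by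
      intro τ hτ
      have hτ0 : τ < 0 := hτ.trans hτ₂
      have hAτ : A τ = α + τ • k + (A τ 2) • e3 := by
        calc A τ = hor (A τ) + (A τ 2) • e3 := self_eq_hor_add _
          _ = (hor (A τ₂) + (τ - τ₂) • k) + (A τ 2) • e3 := by rw [haff τ hτ.le]
          _ = α + τ • k + (A τ 2) • e3 := by rw [hα, sub_smul]; abel
      have hcτ : c τ = k + (c τ 2) • e3 := by
        have h1 := self_eq_hor_add (c τ)
        rw [hhor τ hτ0] at h1
        exact h1
      have hxe : ∀ x : E3, x - (A τ 2) • e3 - α - τ • k = x - A τ := by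
        intro x
        conv_rhs => rw [hAτ]
        abel
      filter_upwards [hrep τ hτ0] with x hx
      rw [hx]
      show v τ (x - A τ) + c τ = v τ (x - (A τ 2) • e3 - α - τ • k) + k + (c τ 2) • e3
      rw [hxe x, add_assoc, ← hcτ]
    -- exact helical symmetry of `Z τ` about the `x₃`-axis for `τ < τ₂`
    have hZsym : ∀ τ < τ₂, ∀ (θ : ℝ) (y : E3), Z τ (rotZ θ y + (h * θ) • e3) = rotZ θ (Z τ y) := by
      intro τ hτ θ y
      have hτ0 : τ < 0 := hτ.trans hτ₂
      have key := helical_transfer (hZgen.continuous_slice hτ) (hsym τ hτ0 θ) (hrepZ τ hτ) y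
      simp only [rotZ_smul_e3, sub_self, zero_add, add_zero] at key
      exact key
    -- H: `Z` has constant slices on `(−∞, τ₂)`; hence `u` has a.e.-constant slices there
    have hZconst := hH h hh τ₂ Z hZgen hZsym
    have hpast : ∀ s : ℝ, s < τ₂ → ∃ b : E3, u s =ᵐ[volume] fun _ => b := by
      intro s hs
      refine ⟨Z s 0 + (c s 2) • e3, ?_⟩
      filter_upwards [hrepZ s hs] with x hx
      rw [hx, hZconst s hs]
    -- F: forward rigidity propagates to all `t < 0`
    exact forwardRigidity_holds u hu hmeas τ₂ hτ₂ hpast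

/-- **Row A8 ⇐ cell A8gen** with every support discharged in kernel. -/
theorem row_A8_of_row_A8gen (hH : Row_A8gen) : Row_A8 :=
  row_A8_of_honest helicalOseenGauge_holds twistRigidity_holds axisDichotomy_holds galileanBoost_holds hH

/-- **Cell A8gen ⇐ row A8**: a genuine exactly screw-symmetric field is in the duality class with measurable
slices, so `Row_A8` makes its slices a.e. constant, hence constant (continuity); general `T` by the time shift. -/
theorem row_A8gen_of_row_A8 (hA8 : Row_A8) : Row_A8gen := by
  intro h hh T w hw hsym τ hτ y
  have hw0 : IsGenuine 0 fun σ y => w (σ + T) y := isGenuine_iff_shift_zero.1 hw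
  have hsym0 : ∀ t < 0, ∀ (θ : ℝ) (x : E3), (fun σ y => w (σ + T) y) t
      (rotZ θ x + (h * θ) • EuclideanSpace.single 2 (1 : ℝ)) = rotZ θ ((fun σ y => w (σ + T) y) t x) :=
    fun t ht θ x => hsym (t + T) (by linarith) θ x
  obtain ⟨b, hb⟩ := hA8 h hh _ hw0.isBoundedAncientMildSolution
    (fun t ht => (hw0.continuous_slice ht).aestronglyMeasurable) hsym0 (τ - T) (by linarith)
  have hcont : Continuous fun y => w (τ - T + T) y := hw0.continuous_slice (t := τ - T) (by linarith)
  have heq : (fun y => w (τ - T + T) y) = fun _ => b :=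
    (Continuous.ae_eq_iff_eq volume hcont continuous_const).1 hb
  have h1 := congr_fun heq y
  have h2 := congr_fun heq 0
  simp only [sub_add_cancel] at h1 h2
  rw [h1, h2]

/-- **Row A8 IS its honest cell.** -/
theorem row_A8_iff_row_A8gen : Row_A8 ↔ Row_A8gen :=
  ⟨row_A8gen_of_row_A8, row_A8_of_row_A8gen⟩

end Summit.NavierStokesRegularity.NavierStokesRegularity.Theorems.ScenarioCensus.RowA8HonestCell

namespace Summit.NavierStokesRegularity.NavierStokesRegularity.Theorems.ScenarioCensus

/-- **Census alias: row A8 ≡ cell A8gen.** -/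
theorem row_A8_iff_row_A8gen : Row_A8 ↔ RowA8HonestCell.Row_A8gen := RowA8HonestCell.row_A8_iff_row_A8gen

end Summit.NavierStokesRegularity.NavierStokesRegularity.Theorems.ScenarioCensus
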